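import Summits.HubbardSuperconductivity.HubbardLadder.PairCorrSectorRows
import Summits.HubbardSuperconductivity.HubbardLadder.EDCalibrationRowAssembly
import Summits.HubbardSuperconductivity.HubbardLadder.Bounds.TorusDopedN14Rows
import HarnessLib

/-!
# Rung R3 — ASSEMBLY of the `L = 4` dichotomy object from `pair_dd` SECTOR-mode certificates
# (the SDP twin of `EDCalibrationRowAssembly`; consumer of `PairCorrSectorCert` / `PairCorrSectorRows`)

HONEST FRAMING (page 1): ladder R1–R4 with certified numbers; no claim on H/H₀. This file proves SOUNDNESS
EDGES and types two obligations (both proved: they are implications from certificates nobody holds); no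
certificate of the kind it consumes exists (no `pair_dd` instance has been run by anyone; result line (iii)
of record, verbatim: no R3 instance has been run; no dichotomy is certified at any size; there are no
brackets to overlap).

WHY THIS FILE. `PairCorrSectorRows` (LEAN REQUEST #116) turns two single-entry `pair_dd` sector
certificates (`λ = ±1`, displacement `r`) for `hubbardTorusTT' 4 1 (-1/4) 8`, sector `(14, S^z = 0)`, plus
a typed UPPER energy claim, into the row `PairCorrWindowCert (fun L => hubbardTorusTT' L 1 (-1/4) 8)
(fun _ => 14) 4 r`. The cell's R3 OBJECT at `L = 4` is
`R3DichotomyU8Eighth 4 r = FiniteDichotomyCert (pureHubbard 8) (fun L => hubbardTorusTT' L 1 (-1/4) 8)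
(electronNumber (1/8)) 4 r` (`R3R4SumRule`), i.e. it is keyed by the PURE family `pureHubbard 8` on the
`t' = 0` side and by the summit's electron number `electronNumber (1/8)` (`= 14` at `L = 4`,
`electronNumber_eighth_four`) on both sides, and its `t' = 0` energy hypothesis is discharged by the
tree's pure-model node `Bounds.torusUpper_mbbootE2_4x4_U8_N14 : groundEnergyAt (fermionTorusGraph 2 4)
1 8 14 ≤ −815606355579/2³⁶` (R3-PAIRROWS-SPEC §7, instance `pairrows-N14`: "t′ = 0 (u from mbboot
j041975)"). Three pieces of glue were missing between the #116 rows and that object; this file supplies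
them (the LIST rows certified by an orbit-averaged entry list — `pairrows-N14`: `(2,0) ⊕ (0,2)`,
`(2,1) ⊕ (1,2)`, coefficients `1/2` — and their dichotomy object are the companion module
`PairCorrListRows`, which imports this one):

* §5 `PairCorrWindowCert.transport` — a row for `(H, N)` at side `L` IS a row for any `(H', N')` with
  `H' L = H L`, `N' L = N L` (same ends); the `t–t'` row at `(fun _ => 14)` becomes the row at
  `electronNumber (1/8)`, the `t' = 0` row becomes a row of `pureHubbard 8` (`pureHubbard_eight_four`).
* §6 the `t' = 0` COMPANION of #116 §4: `groundEnergy (hubbardTorusTT' L t 0 U) N = groundEnergyAt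
  (fermionTorusGraph 2 L) t U N` (`hubbardTorusTT'_zero`), hence ANY typed pure-model upper claim
  `groundEnergyAt (fermionTorusGraph 2 L) t U (2 nh) ≤ u` (or its `fermionRectTorusGraph L L` reading, the
  Slater leaves' shape) is the energy hypothesis of a `t' = 0` certificate written with that `u`;
  `pairCorrWindowCert_4x4_U8_N14_tp0_of_certs`, and `…_of_mbbootE2` keyed to the in-tree node
  (`u := −815606355579/2³⁶`; a file written against another `u'` is consumed only with a node for `u'` —
  `κ (u' − u)` is not free).
* §7 ASSEMBLY: four single-entry certificates (`t' = 0`: values `q₊⁰, q₋⁰` at hypothesis `u₀`;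
  `t' = −1/4`: `q₊¹, q₋¹` at `u₁`), the two typed upper claims, and the separation test
  `max |q₊⁰| |q₋⁰| < q₊¹` give a term of `R3DichotomyU8Eighth 4 r` with `a = max |q₊⁰| |q₋⁰| / 16`,
  `b = q₊¹ / 16` (`r3DichotomyFour_of_sectorPairCerts`); typed obligations `PairDDRowAssemblyFour` (any
  `u₀`, `u₁`) and `PairDDRowAssemblyFourE2` (`u₀` := the E2 node's constant, hypothesis
  `Bounds.torusUpper_mbbootE2_4x4_U8_N14`), both PROVED. When the test fails the result line reads
  "brackets overlap: no dichotomy certified at this size" and no term is produced — both are results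
  (brief (iii)).

Every hypothesis is a binder or a structure field; nothing about the Hubbard ground state is assumed; no
number is introduced except the in-tree node's constant, by name. A concrete certificate enters the tree
exactly as the energy rows do: a claim node `Nonempty (TorusSectorObsCertTT' 4 1 t' 8 14 0 u X q)` whose
evidence is the verifier-B-passed file.

## References
* J. Wang et al., *Certifying ground-state properties of many-body systems*, PRX 14 (2024) 031006,
  §3 eq. (obsopt). [cite: WangEtAl2024, §3 eq. (obsopt)]
* M. Qin et al., PRX 10 (2020) 031016, §II eqs. (2)–(4), §III.B. [cite: QinEtAl2020, §II eqs. (2)–(4)]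
* H. Xu et al., Science 384 (2024) eadh7691, §II (the `t'/t ≈ −0.2` contrast). [cite: XuEtAl2024, §II]
* E. H. Lieb, PRL 62 (1989) 1201, proof of Thm 1 (`S^z = 0` representatives). [cite: LiebPRL1989]
* Cell documents: `pub-hubbard-r3/R3-PAIRROWS-SPEC.md` §4, §5′, §7; `pub-hubbard-r3/R3-DESIGN.md` §16–§17;
  `run/shared/lean/engines/code/certsdp/docs/FORMAT-certsdp1-addendum-pairdd-draft.md` (rev 3) P-1–P-3.
-/

noncomputable section

namespace Summit.HubbardSuperconductivity.HubbardLadder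

open Matrix Finset Literature.MathematicalPhysics.QuantumLattice Literature.Probability.LatticeModels
open scoped ComplexOrder

/-! ## §5 Transport of a row along families that agree at the side in question -/

namespace PairCorrWindowCert

variable {H H' : TorusHamiltonianFamily} {N N' : ℕ → ℕ} {L : ℕ} {r : Site 2}

/-- A certified window for `(H, N)` at side `L` is a certified window, with the same ends, for every
family `(H', N')` that agrees with `(H, N)` at `L`. [folklore] -/
def transport (w : PairCorrWindowCert H N L r) (hH : H' L = H L) (hN : N' L = N L) :
    PairCorrWindowCert H' N' L r where
  lo := w.lo
  hi := w.hi
  sound ψ h₁ h₂ := w.sound ψ h₁ (by rw [hH, hN] at h₂; exact h₂)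

/-- Transport keeps the lower end. [folklore] -/
@[simp] theorem transport_lo (w : PairCorrWindowCert H N L r) (hH : H' L = H L) (hN : N' L = N L) :
    (w.transport hH hN).lo = w.lo := rfl

/-- Transport keeps the upper end. [folklore] -/
@[simp] theorem transport_hi (w : PairCorrWindowCert H N L r) (hH : H' L = H L) (hN : N' L = N L) :
    (w.transport hH hN).hi = w.hi := rfl

end PairCorrWindowCert

/-! ## §6 The `t' = 0` companion of the energy-hypothesis glue (pure-model upper nodes) -/

section PureCompanion

variable {L : ℕ}

/-- At `t' = 0` the `t–t'` torus ground energy in the `N`-particle sector is the tree's pure-model R1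
object `groundEnergyAt (fermionTorusGraph 2 L) t U N` (`hubbardTorusTT'_zero`). [folklore] -/
theorem groundEnergy_hubbardTorusTT'_zero (t U : ℝ) (N : ℕ) :
    groundEnergy (hubbardTorusTT' L t 0 U) N = groundEnergyAt (fermionTorusGraph 2 L) t U N := by
  rw [hubbardTorusTT'_zero]; rfl

variable [NeZero L]

/-- **Pure-model upper claim ⇒ energy hypothesis at `t' = 0`.** For even `N = 2 nh ≤ 2 L²`, a typed claim
`groundEnergyAt (fermionTorusGraph 2 L) t U (2 nh) ≤ u` (the shape of the pure-model upper leaves of the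
cell and of pub-mbboot: E2 Lanczos nodes, LUC) IS the hypothesis
`minEnergyOn (hubbardTorusTT' L t 0 U) (szSector (2 nh) 0) ≤ u` of the sector-certificate edges
(`minEnergyOn_szSector_le_of_groundEnergy_le`, Lieb's `S^z = 0` representative). [cite: LiebPRL1989] -/
theorem minEnergyOn_szSector_zero_le_of_groundEnergyAt_le (t U : ℝ) {nh : ℕ}
    (hn : nh ≤ Fintype.card (FermionTorus 2 L)) {u : ℝ}
    (h : groundEnergyAt (fermionTorusGraph 2 L) t U (2 * nh) ≤ u) :
    (hubbardTorusTT' L t 0 U).minEnergyOn (szSector (2 * nh) 0) ≤ u :=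
  minEnergyOn_szSector_le_of_groundEnergy_le (L := L) t 0 U hn
    (by rwa [groundEnergy_hubbardTorusTT'_zero])

/-- The same from a claim in the RECTANGULAR reading `groundEnergyAt (fermionRectTorusGraph L L) t U (2 nh) ≤ u`
(the Slater leaves' shape, e.g. `Bounds.slaterUpper_4x4_U8_N14_uhf`; `groundEnergyAt_fermionTorusGraph_two`).
[cite: LiebPRL1989] -/
theorem minEnergyOn_szSector_zero_le_of_groundEnergyAt_rect_le (t U : ℝ) {nh : ℕ}
    (hn : nh ≤ Fintype.card (FermionTorus 2 L)) {u : ℝ}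
    (h : groundEnergyAt (fermionRectTorusGraph L L) t U (2 * nh) ≤ u) :
    (hubbardTorusTT' L t 0 U).minEnergyOn (szSector (2 * nh) 0) ≤ u :=
  minEnergyOn_szSector_zero_le_of_groundEnergyAt_le t U hn (by rwa [groundEnergyAt_fermionTorusGraph_two])

end PureCompanion

section FourByFour

/-- `7 ≤ |Λ| = 16` on the `4 × 4` torus (the capacity check of the `(7,7)` sector). [folklore] -/
theorem seven_le_card_fermionTorus_four : 7 ≤ Fintype.card (FermionTorus 2 4) := by
  simp [FermionTorus, Fintype.card_pi]

/-- **The `t' = 0` row, end to end (no number introduced).** On the `4 × 4` torus at `t = 1`, `t' = 0`,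
`U = 8`, sector `(14, S^z = 0)`: two single-entry `pair_dd` certificates at displacement `r` with
energy-hypothesis constant `u`, plus ANY typed pure-model upper claim
`groundEnergyAt (fermionTorusGraph 2 4) 1 8 14 ≤ u`, give the row
`PairCorrWindowCert (fun L => hubbardTorusTT' L 1 0 8) (fun _ => 14) 4 r` with window `[q₊/16, −q₋/16]`.
The certificate's identity is written against `hubbardTorusTT' 4 1 0 8` (`= hubbardTorus 2 4 1 8`, the
producer's physical `H`, `hubbardTorusTT'_zero`). HONEST FRAMING: ladder R1–R4 with certified numbers; no
claim on H/H₀. [cite: QinEtAl2020, §II eqs. (2)–(4)] -/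
def pairCorrWindowCert_4x4_U8_N14_tp0_of_certs (r : Site 2) {u qp qm : ℝ}
    (Cp : TorusSectorObsCertTT' 4 1 0 8 14 0 u
      (pairListObjective 4 (fun _ : Fin 1 => (1 : ℝ)) (fun _ => r)) qp)
    (Cm : TorusSectorObsCertTT' 4 1 0 8 14 0 u
      (pairListObjective 4 (fun _ : Fin 1 => (-1 : ℝ)) (fun _ => r)) qm)
    (hup : groundEnergyAt (fermionTorusGraph 2 4) 1 8 14 ≤ u) :
    PairCorrWindowCert (fun L => hubbardTorusTT' L 1 0 8) (fun _ => 14) 4 r :=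
  have hE : (hubbardTorusTT' 4 1 0 8).minEnergyOn (szSector 14 0) ≤ u :=
    minEnergyOn_szSector_zero_le_of_groundEnergyAt_le (L := 4) 1 8 (nh := 7)
      seven_le_card_fermionTorus_four hup
  PairCorrWindowCert.ofSectorPairCerts 3 1 0 8 (fun _ => 14) r Cp Cm hE hE

/-- Its window, for the record: `[q₊/16, −q₋/16]`. [folklore] -/
theorem pairCorrWindowCert_4x4_U8_N14_tp0_of_certs_lo_hi (r : Site 2) {u qp qm : ℝ}
    (Cp : TorusSectorObsCertTT' 4 1 0 8 14 0 u
      (pairListObjective 4 (fun _ : Fin 1 => (1 : ℝ)) (fun _ => r)) qp)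
    (Cm : TorusSectorObsCertTT' 4 1 0 8 14 0 u
      (pairListObjective 4 (fun _ : Fin 1 => (-1 : ℝ)) (fun _ => r)) qm)
    (hup : groundEnergyAt (fermionTorusGraph 2 4) 1 8 14 ≤ u) :
    (pairCorrWindowCert_4x4_U8_N14_tp0_of_certs r Cp Cm hup).lo = qp / 16 ∧
      (pairCorrWindowCert_4x4_U8_N14_tp0_of_certs r Cp Cm hup).hi = -qm / 16 := by
  constructor
  · show qp / ((3 + 1 : ℕ) : ℝ) ^ 2 = qp / 16; norm_num
  · show -qm / ((3 + 1 : ℕ) : ℝ) ^ 2 = -qm / 16; norm_num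

/-- **Keyed to the IN-TREE pure-model node.** With the INHERITED E2 upper claim
`Bounds.torusUpper_mbbootE2_4x4_U8_N14` (`E₀(4 × 4, t' = 0, U = 8, N = 14) ≤ −815606355579/2³⁶ ≈ −11.8686345`;
pub-mbboot-sdp2 Lanczos Rayleigh quotient, NOT referee-replayed) as the energy hypothesis, two single-entry
`t' = 0` certificates written with `u := −815606355579/2³⁶` give the `t' = 0` row (R3-PAIRROWS-SPEC §7,
`pairrows-N14`, `t' = 0` legs). HONEST FRAMING: ladder R1–R4 with certified numbers; no claim on H/H₀.
[cite: QinEtAl2020, §II eqs. (2)–(4)] -/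
def pairCorrWindowCert_4x4_U8_N14_tp0_of_mbbootE2 (r : Site 2) {qp qm : ℝ}
    (Cp : TorusSectorObsCertTT' 4 1 0 8 14 0 ((-815606355579 : ℝ) / 2 ^ 36)
      (pairListObjective 4 (fun _ : Fin 1 => (1 : ℝ)) (fun _ => r)) qp)
    (Cm : TorusSectorObsCertTT' 4 1 0 8 14 0 ((-815606355579 : ℝ) / 2 ^ 36)
      (pairListObjective 4 (fun _ : Fin 1 => (-1 : ℝ)) (fun _ => r)) qm)
    (hup : Bounds.torusUpper_mbbootE2_4x4_U8_N14) :
    PairCorrWindowCert (fun L => hubbardTorusTT' L 1 0 8) (fun _ => 14) 4 r :=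
  pairCorrWindowCert_4x4_U8_N14_tp0_of_certs r Cp Cm (Bounds.groundEnergyAt_4x4_U8_N14_le_of_claim hup)

/-! ## §7 Assembly of `R3DichotomyU8Eighth 4 r` from four single-entry certificates -/

/-- The `t' = 0` row read as a row of the PURE family `pureHubbard 8` at the summit's electron number
`electronNumber (1/8)` (`pureHubbard_eight_four`, `electronNumber_eighth_four`). [folklore] -/
def r3WindowPure_of_sectorPairCerts (r : Site 2) {u qp qm : ℝ}
    (Cp : TorusSectorObsCertTT' 4 1 0 8 14 0 u
      (pairListObjective 4 (fun _ : Fin 1 => (1 : ℝ)) (fun _ => r)) qp)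
    (Cm : TorusSectorObsCertTT' 4 1 0 8 14 0 u
      (pairListObjective 4 (fun _ : Fin 1 => (-1 : ℝ)) (fun _ => r)) qm)
    (hup : groundEnergyAt (fermionTorusGraph 2 4) 1 8 14 ≤ u) :
    PairCorrWindowCert (pureHubbard 8) (electronNumber (1 / 8)) 4 r :=
  (pairCorrWindowCert_4x4_U8_N14_tp0_of_certs r Cp Cm hup).transport
    pureHubbard_eight_four electronNumber_eighth_four

/-- The `t' = −1/4` row of #116 §4 read at the summit's electron number `electronNumber (1/8)`.
[folklore] -/
def r3WindowTPrime_of_sectorPairCerts (r : Site 2) {u qp qm : ℝ}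
    (Cp : TorusSectorObsCertTT' 4 1 ((-1 : ℝ) / 4) 8 14 0 u
      (pairListObjective 4 (fun _ : Fin 1 => (1 : ℝ)) (fun _ => r)) qp)
    (Cm : TorusSectorObsCertTT' 4 1 ((-1 : ℝ) / 4) 8 14 0 u
      (pairListObjective 4 (fun _ : Fin 1 => (-1 : ℝ)) (fun _ => r)) qm)
    (hup : groundEnergy (hubbardRectTorusTT' 4 4 1 ((-1 : ℝ) / 4) 8) 14 ≤ u) :
    PairCorrWindowCert (fun L => hubbardTorusTT' L 1 (-1 / 4) 8) (electronNumber (1 / 8)) 4 r :=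
  (pairCorrWindowCert_4x4_U8_N14_tpm1o4_of_certs r Cp Cm hup).transport rfl electronNumber_eighth_four

/-- `max |q₊⁰| |q₋⁰| < q₊¹` is the separation test `max |q₊⁰/16| |−q₋⁰/16| < q₊¹/16` of the two windows.
[folklore] -/
theorem max_abs_div_sixteen_lt {qp₀ qm₀ qp₁ : ℝ} (h : max |qp₀| |qm₀| < qp₁) :
    max |qp₀ / 16| |-qm₀ / 16| < qp₁ / 16 := by
  have h16 : (0 : ℝ) < 16 := by norm_num
  rw [abs_div, abs_div, abs_neg, abs_of_pos h16, max_div_div_right h16.le]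
  exact div_lt_div_of_pos_right h h16

/-- **R3 at `L = 4` from `pair_dd` SECTOR certificates.** Four single-entry certificates at displacement
`r` — `t' = 0`: `λ = +1` value `q₊⁰`, `λ = −1` value `q₋⁰`, both at energy hypothesis `u₀`; `t' = −1/4`:
`q₊¹`, `q₋¹` at `u₁` — the typed upper claims `groundEnergyAt (fermionTorusGraph 2 4) 1 8 14 ≤ u₀` (pure
model) and `groundEnergy (hubbardRectTorusTT' 4 4 1 (−1/4) 8) 14 ≤ u₁`, and the separation test
`max |q₊⁰| |q₋⁰| < q₊¹`, give the cell's R3 object `R3DichotomyU8Eighth 4 r` with `a = max |q₊⁰| |q₋⁰| / 16`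
and `b = q₊¹ / 16` (`FiniteDichotomyCert.ofWindows`). NOTHING RUN; when the test fails the line of record is
"brackets overlap: no dichotomy certified at this size". HONEST FRAMING: ladder R1–R4 with certified
numbers; no claim on H/H₀. [cite: QinEtAl2020, §III.B] [cite: XuEtAl2024, §II] -/
def r3DichotomyFour_of_sectorPairCerts (r : Site 2) {u₀ u₁ qp₀ qm₀ qp₁ qm₁ : ℝ}
    (Cp₀ : TorusSectorObsCertTT' 4 1 0 8 14 0 u₀
      (pairListObjective 4 (fun _ : Fin 1 => (1 : ℝ)) (fun _ => r)) qp₀)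
    (Cm₀ : TorusSectorObsCertTT' 4 1 0 8 14 0 u₀
      (pairListObjective 4 (fun _ : Fin 1 => (-1 : ℝ)) (fun _ => r)) qm₀)
    (hup₀ : groundEnergyAt (fermionTorusGraph 2 4) 1 8 14 ≤ u₀)
    (Cp₁ : TorusSectorObsCertTT' 4 1 ((-1 : ℝ) / 4) 8 14 0 u₁
      (pairListObjective 4 (fun _ : Fin 1 => (1 : ℝ)) (fun _ => r)) qp₁)
    (Cm₁ : TorusSectorObsCertTT' 4 1 ((-1 : ℝ) / 4) 8 14 0 u₁
      (pairListObjective 4 (fun _ : Fin 1 => (-1 : ℝ)) (fun _ => r)) qm₁)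
    (hup₁ : groundEnergy (hubbardRectTorusTT' 4 4 1 ((-1 : ℝ) / 4) 8) 14 ≤ u₁)
    (h : max |qp₀| |qm₀| < qp₁) : R3DichotomyU8Eighth 4 r :=
  FiniteDichotomyCert.ofWindows (r3WindowPure_of_sectorPairCerts r Cp₀ Cm₀ hup₀)
    (r3WindowTPrime_of_sectorPairCerts r Cp₁ Cm₁ hup₁) (by
      show max |qp₀ / ((3 + 1 : ℕ) : ℝ) ^ 2| |-qm₀ / ((3 + 1 : ℕ) : ℝ) ^ 2| < qp₁ / ((3 + 1 : ℕ) : ℝ) ^ 2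
      norm_num only [Nat.cast_ofNat]
      exact max_abs_div_sixteen_lt h)

/-- Its levels, for the record: `a = max |q₊⁰/16| |−q₋⁰/16|`, `b = q₊¹/16`. [folklore] -/
theorem r3DichotomyFour_of_sectorPairCerts_a_b (r : Site 2) {u₀ u₁ qp₀ qm₀ qp₁ qm₁ : ℝ}
    (Cp₀ : TorusSectorObsCertTT' 4 1 0 8 14 0 u₀
      (pairListObjective 4 (fun _ : Fin 1 => (1 : ℝ)) (fun _ => r)) qp₀)
    (Cm₀ : TorusSectorObsCertTT' 4 1 0 8 14 0 u₀
      (pairListObjective 4 (fun _ : Fin 1 => (-1 : ℝ)) (fun _ => r)) qm₀)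
    (hup₀ : groundEnergyAt (fermionTorusGraph 2 4) 1 8 14 ≤ u₀)
    (Cp₁ : TorusSectorObsCertTT' 4 1 ((-1 : ℝ) / 4) 8 14 0 u₁
      (pairListObjective 4 (fun _ : Fin 1 => (1 : ℝ)) (fun _ => r)) qp₁)
    (Cm₁ : TorusSectorObsCertTT' 4 1 ((-1 : ℝ) / 4) 8 14 0 u₁
      (pairListObjective 4 (fun _ : Fin 1 => (-1 : ℝ)) (fun _ => r)) qm₁)
    (hup₁ : groundEnergy (hubbardRectTorusTT' 4 4 1 ((-1 : ℝ) / 4) 8) 14 ≤ u₁)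
    (h : max |qp₀| |qm₀| < qp₁) :
    (r3DichotomyFour_of_sectorPairCerts r Cp₀ Cm₀ hup₀ Cp₁ Cm₁ hup₁ h).a = max |qp₀ / 16| |-qm₀ / 16| ∧
      (r3DichotomyFour_of_sectorPairCerts r Cp₀ Cm₀ hup₀ Cp₁ Cm₁ hup₁ h).b = qp₁ / 16 := by
  constructor
  · show max |qp₀ / ((3 + 1 : ℕ) : ℝ) ^ 2| |-qm₀ / ((3 + 1 : ℕ) : ℝ) ^ 2| = _; norm_num
  · show qp₁ / ((3 + 1 : ℕ) : ℝ) ^ 2 = _; norm_num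

/-- **Typed obligation (assembly of the R3 row at `L = 4` from `pair_dd` sector certificates)**: four
single-entry sector certificates as in `r3DichotomyFour_of_sectorPairCerts`, the two typed upper energy
claims, and `max |q₊⁰| |q₋⁰| < q₊¹` yield the R3 dichotomy object at `(4, r)` with
`a = max |q₊⁰/16| |−q₋⁰/16|`, `b = q₊¹/16`. PROVED (`pairDDRowAssemblyFour_holds`); NO such certificate exists
(nothing has been run). HONEST FRAMING: ladder R1–R4 with certified numbers; no claim on H/H₀. -/
@[conjecture] def PairDDRowAssemblyFour : Prop :=
  ∀ (r : Site 2) (u₀ u₁ qp₀ qm₀ qp₁ qm₁ : ℝ),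
    Nonempty (TorusSectorObsCertTT' 4 1 0 8 14 0 u₀
      (pairListObjective 4 (fun _ : Fin 1 => (1 : ℝ)) (fun _ => r)) qp₀) →
    Nonempty (TorusSectorObsCertTT' 4 1 0 8 14 0 u₀
      (pairListObjective 4 (fun _ : Fin 1 => (-1 : ℝ)) (fun _ => r)) qm₀) →
    groundEnergyAt (fermionTorusGraph 2 4) 1 8 14 ≤ u₀ →
    Nonempty (TorusSectorObsCertTT' 4 1 ((-1 : ℝ) / 4) 8 14 0 u₁
      (pairListObjective 4 (fun _ : Fin 1 => (1 : ℝ)) (fun _ => r)) qp₁) →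
    Nonempty (TorusSectorObsCertTT' 4 1 ((-1 : ℝ) / 4) 8 14 0 u₁
      (pairListObjective 4 (fun _ : Fin 1 => (-1 : ℝ)) (fun _ => r)) qm₁) →
    groundEnergy (hubbardRectTorusTT' 4 4 1 ((-1 : ℝ) / 4) 8) 14 ≤ u₁ →
    max |qp₀| |qm₀| < qp₁ →
      ∃ c : R3DichotomyU8Eighth 4 r, c.a = max |qp₀ / 16| |-qm₀ / 16| ∧ c.b = qp₁ / 16

/-- **Proof of `PairDDRowAssemblyFour`.** -/
theorem pairDDRowAssemblyFour_holds : PairDDRowAssemblyFour := by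
  rintro r u₀ u₁ qp₀ qm₀ qp₁ qm₁ ⟨Cp₀⟩ ⟨Cm₀⟩ hup₀ ⟨Cp₁⟩ ⟨Cm₁⟩ hup₁ h
  exact ⟨r3DichotomyFour_of_sectorPairCerts r Cp₀ Cm₀ hup₀ Cp₁ Cm₁ hup₁ h,
    r3DichotomyFour_of_sectorPairCerts_a_b r Cp₀ Cm₀ hup₀ Cp₁ Cm₁ hup₁ h⟩

/-- **Typed obligation, `t' = 0` legs keyed to the IN-TREE E2 node** (R3-PAIRROWS-SPEC §7 `pairrows-N14`:
"`t' = 0` (u from mbboot j041975)"): the `t' = 0` certificates are written with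
`u₀ := −815606355579/2³⁶` and their energy hypothesis is the INHERITED node
`Bounds.torusUpper_mbbootE2_4x4_U8_N14` (NOT referee-replayed); the `t' = −1/4` legs keep a generic typed
upper claim `u₁` (the T-UP `4 × 4` leaf once typed, or `Bounds.slaterUpper_4x4_U8_N14_tpm1o4_uhf` via
`pairCorrWindowCert_4x4_U8_N14_tpm1o4_of_slaterUpper`'s hypothesis shape). PROVED; NO such certificate
exists. HONEST FRAMING: ladder R1–R4 with certified numbers; no claim on H/H₀. -/
@[conjecture] def PairDDRowAssemblyFourE2 : Prop :=
  ∀ (r : Site 2) (u₁ qp₀ qm₀ qp₁ qm₁ : ℝ),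
    Nonempty (TorusSectorObsCertTT' 4 1 0 8 14 0 ((-815606355579 : ℝ) / 2 ^ 36)
      (pairListObjective 4 (fun _ : Fin 1 => (1 : ℝ)) (fun _ => r)) qp₀) →
    Nonempty (TorusSectorObsCertTT' 4 1 0 8 14 0 ((-815606355579 : ℝ) / 2 ^ 36)
      (pairListObjective 4 (fun _ : Fin 1 => (-1 : ℝ)) (fun _ => r)) qm₀) →
    Bounds.torusUpper_mbbootE2_4x4_U8_N14 →
    Nonempty (TorusSectorObsCertTT' 4 1 ((-1 : ℝ) / 4) 8 14 0 u₁
      (pairListObjective 4 (fun _ : Fin 1 => (1 : ℝ)) (fun _ => r)) qp₁) →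
    Nonempty (TorusSectorObsCertTT' 4 1 ((-1 : ℝ) / 4) 8 14 0 u₁
      (pairListObjective 4 (fun _ : Fin 1 => (-1 : ℝ)) (fun _ => r)) qm₁) →
    groundEnergy (hubbardRectTorusTT' 4 4 1 ((-1 : ℝ) / 4) 8) 14 ≤ u₁ →
    max |qp₀| |qm₀| < qp₁ →
      ∃ c : R3DichotomyU8Eighth 4 r, c.a = max |qp₀ / 16| |-qm₀ / 16| ∧ c.b = qp₁ / 16

/-- **Proof of `PairDDRowAssemblyFourE2`** (`pairDDRowAssemblyFour_holds` at
`u₀ := −815606355579/2³⁶`, the node's inequality by `Bounds.groundEnergyAt_4x4_U8_N14_le_of_claim`). -/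
theorem pairDDRowAssemblyFourE2_holds : PairDDRowAssemblyFourE2 :=
  fun r u₁ qp₀ qm₀ qp₁ qm₁ hCp₀ hCm₀ hup₀ =>
    pairDDRowAssemblyFour_holds r _ u₁ qp₀ qm₀ qp₁ qm₁ hCp₀ hCm₀
      (Bounds.groundEnergyAt_4x4_U8_N14_le_of_claim hup₀)

end FourByFour

end Summit.HubbardSuperconductivity.HubbardLadder
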